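import Literature.NumberTheory.LFunctions.RayClassSieveDensity
import Literature.NumberTheory.LFunctions.ClassGroupMeanValue
import HarnessLib

/-!
# The log-free mean value theorem for the characters of a congruence class group `mod 𝔪`
# (Thorner–Zaman 2017, Theorem 4.1; Weiss 1983, Theorem 4.2)

Topic `Literature/NumberTheory/LFunctions`, namespace `Literature.NumberTheory.LFunctions.AbelianDensity`.
Everything here is PROVED (one definition with body, theorems; no named facts).

The tree's `ClassGroupMeanValue.classGroup_meanValue_le` is Thorner–Zaman's log-free large sieve for the
characters of the class group (`H = P_K`).  This file proves it for the characters `χ ∘ f` of an arbitrary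
abelian Frobenius datum `f : 𝔭 ↦ f 𝔭 ∈ G` killing the narrow ray `mod 𝔪 ≠ 0` whose non-trivial characters
are non-principal on the primes `∤ 𝔪` — i.e. for the Hecke characters of any congruence class group
`H ⊇ P^𝔪` (`G = J^𝔪/H`; for `G = Cl_K^𝔪`: all ray class characters `mod 𝔪`): for complex numbers `b(𝔭)`
on finitely many prime ideals `𝔭 ∤ 𝔪` of norm `> y ≥ z ≥ 1`, Weiss's kernel of order `m + 1 ≥ n_K + 4`,
parameter `A > 0`, and `0 < T` with `(m+1)T² ≤ 3A²`,
  `Σ_χ ∫_{−T}^{T} |Σ_𝔭 b(𝔭) χ(f 𝔭) N𝔭^{−it}|² dt ≤ 8π · |G| M · Σ_𝔭 N𝔭 |b(𝔭)|²`,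
  `M = (κ_K φ(𝔪)/(N𝔪|G|))/V'_𝔪(z) + |D_z(𝔪)|² err_𝔪(log y − (m+1)/A) z`   (`rayMeanValueConst`),
so that `|G| M ≪ e^{n_K}/log z + (secondary)` by `RayClassSieveDensity` — the log-free saving `1/log y`
of [ThornerZaman2017, Theorem 4.1].  Ingredients: Gallagher's lemma with Weiss's kernel
(`WeissKernel.gallagher`), Parseval on `G`, Cauchy–Schwarz inside each coset, and the sifted coset sums
`RayClassSiftedSums.sifted_fiberSum_le`.
* `sum_norm_sq_charSum_eq_card_mul` — Parseval on a finite abelian group;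
* `sum_sifted_fiber_phi_div_le`, `sum_norm_sq_smoothed_fiber_le` — the sieve input and the pointwise bound;
* `congruence_meanValue_le` (ideals), `congruence_meanValue_primes_le` (prime ideals) — **Theorem 4.1**.

## References
* [ThornerZaman2017] J. Thorner, A. Zaman, *An explicit bound for the least prime ideal in the Chebotarev
  density theorem*, Algebra Number Theory 11 (2017), Theorem 4.1, §4.2.
* [Weiss1983] A. Weiss, *The least prime ideal*, J. reine angew. Math. 338 (1983), Theorem 4.2, §3.
-/

noncomputable section

open MeasureTheory Real Complex Set Filter Finset IsDedekindDomain NumberField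
open scoped Topology

namespace Literature.NumberTheory.LFunctions.AbelianDensity

open Literature.NumberTheory.LFunctions.WeissKernel Literature.NumberTheory.LFunctions.NumberField
  Literature.NumberTheory.Sieve.Squarefree
open scoped nonZeroDivisors _root_.NumberField Classical

variable {K : Type*} [Field K] [NumberField K]
variable {G : Type*} [CommGroup G] [Finite G] {𝔪 : Ideal (𝓞 K)} {f : HeightOneSpectrum (𝓞 K) → G}

/-! ### Parseval on `G` -/

/-- **Parseval on the finite abelian group `G`**: `Σ_χ |Σ_τ χ(τ) a(τ)|² = |G| Σ_τ |a(τ)|²`.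
[cite: ThornerZaman2017, Theorem 4.1] -/
theorem sum_norm_sq_charSum_eq_card_mul [Fintype G] (a : G → ℂ) :
    ∑ ψ : AddChar (Additive G) ℂ, ‖∑ C : G, ψ (Additive.ofMul C) * a C‖ ^ 2 =
      Fintype.card G * ∑ C : G, ‖a C‖ ^ 2 := by
  apply Complex.ofReal_injective
  simp only [Complex.ofReal_sum, Complex.ofReal_mul, Complex.ofReal_natCast]
  have hsq : ∀ w : ℂ, ((‖w‖ ^ 2 : ℝ) : ℂ) = w * starRingEnd ℂ w := by
    intro w; rw [Complex.mul_conj, Complex.normSq_eq_norm_sq]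
  simp_rw [hsq, map_sum, map_mul, Finset.sum_mul_sum]
  have hconj : ∀ (ψ : AddChar (Additive G) ℂ) (C : G),
      starRingEnd ℂ (ψ (Additive.ofMul C)) = ψ (Additive.ofMul C⁻¹) := by
    intro ψ C
    rw [ofMul_inv, AddChar.map_neg_eq_inv, Complex.inv_eq_conj (AddChar.norm_apply ψ _)]
  have hterm : ∀ (ψ : AddChar (Additive G) ℂ) (C C' : G),
      ψ (Additive.ofMul C) * a C * (starRingEnd ℂ (ψ (Additive.ofMul C')) * starRingEnd ℂ (a C')) =
        ψ (Additive.ofMul (C * C'⁻¹)) * (a C * starRingEnd ℂ (a C')) := by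
    intro ψ C C'
    rw [hconj, ofMul_mul, AddChar.map_add_eq_mul]; ring
  simp_rw [hterm]
  rw [Finset.sum_comm]
  have horth : ∀ D : G, ∑ ψ : AddChar (Additive G) ℂ, ψ (Additive.ofMul D) =
      if D = 1 then (Fintype.card G : ℂ) else 0 := by
    intro D
    rw [AddChar.sum_apply_eq_ite, Fintype.card_congr (Additive.toMul (α := G))]
    by_cases hD : D = 1
    · rw [if_pos hD, if_pos (ofMul_eq_zero.2 hD)]
    · rw [if_neg hD, if_neg (mt ofMul_eq_zero.1 hD)]
  simp_rw [Finset.sum_comm (s := (univ : Finset (AddChar (Additive G) ℂ))), ← Finset.sum_mul, horth,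
    mul_inv_eq_one, ite_mul, zero_mul]
  rw [Finset.mul_sum]
  refine Finset.sum_congr rfl fun C _ ↦ ?_
  rw [Finset.sum_ite_eq Finset.univ C, if_pos (Finset.mem_univ _)]

/-! ### The mean value constant and the sieve input per coset -/

variable (K) in
/-- The constant `M = (κ_K φ(𝔪)/(N𝔪 h))/V'_𝔪(z) + |D_z(𝔪)|² err_𝔪(log y − (m+1)/A) z` of the mean value theorem
for a congruence class group of order `h` modulo `𝔪`. [cite: ThornerZaman2017, Theorem 4.1] -/
def rayMeanValueConst (𝔪 : Ideal (𝓞 K)) (h𝔪 : 𝔪 ≠ ⊥) (h : ℕ) (A : ℝ) (m : ℕ) (z y : ℝ) : ℝ :=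
  (coprimeResidue K 𝔪 h𝔪 / h) /
      bigV (fun v : HeightOneSpectrum (𝓞 K) ↦ (Ideal.absNorm v.asIdeal : ℝ)) (admissibleCoprime K 𝔪 z) +
    ((admissibleCoprime K 𝔪 z).card : ℝ) ^ 2 * (rayErr K 𝔪 A m (Real.log y - ((m : ℝ) + 1) / A) * z)

/-- `M ≥ 0`. [cite: ThornerZaman2017, Theorem 4.1] -/
theorem rayMeanValueConst_nonneg (h𝔪 : 𝔪 ≠ ⊥) (h : ℕ) (A : ℝ) (m : ℕ) {z : ℝ} (hz : 1 ≤ z) (y : ℝ) :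
    0 ≤ rayMeanValueConst K 𝔪 h𝔪 h A m z y := by
  rw [rayMeanValueConst]
  have hN : ∀ v : HeightOneSpectrum (𝓞 K), 1 < (Ideal.absNorm v.asIdeal : ℝ) := one_lt_absNorm_real
  have hV := bigV_pos hN ⟨∅, empty_mem_admissibleCoprime (K := K) (𝔪 := 𝔪) hz⟩
  have hκ : 0 ≤ coprimeResidue K 𝔪 h𝔪 / h := div_nonneg (coprimeResidue_pos h𝔪).le (Nat.cast_nonneg _)
  have : 0 ≤ rayErr K 𝔪 A m (Real.log y - ((m : ℝ) + 1) / A) * z :=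
    mul_nonneg (rayErr_nonneg 𝔪 A m _) (by linarith)
  positivity

/-- **The sieve input per coset**: for nonzero ideals `𝔫 ∈ P` prime to `𝔪`, of norm `> y`, free of prime
factors `𝔭 ∤ 𝔪` of norm `≤ z`, and `u ≥ log y − (m+1)/A`: `Σ_{𝔫 ∈ P, F(𝔫) = τ} φ(u − log N𝔫)/N𝔫 ≤ M`
(`sifted_fiberSum_le`). [cite: ThornerZaman2017, Theorem 4.1] -/
theorem sum_sifted_fiber_phi_div_le (h𝔪 : 𝔪 ≠ ⊥) (hray : ArtinKillsRay 𝔪 f)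
    (hsep : ∀ χ : AddChar (Additive G) ℂ, χ ≠ 0 →
      ∃ v : HeightOneSpectrum (𝓞 K), ¬ 𝔪 ≤ v.asIdeal ∧ χ (Additive.ofMul (f v)) ≠ 1)
    (Pset : Finset (Ideal (𝓞 K))) (τ : G)
    {A : ℝ} (hA : 0 < A) {m : ℕ} (hm : Module.finrank ℚ K + 3 ≤ m) {z y : ℝ} (hz : 1 ≤ z)
    (h0 : ∀ I ∈ Pset, I ≠ ⊥) (hcop : ∀ I ∈ Pset, IsCoprime I 𝔪)
    (hsft : ∀ I ∈ Pset, ∀ w : HeightOneSpectrum (𝓞 K), (Ideal.absNorm w.asIdeal : ℝ) ≤ z →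
      ¬ 𝔪 ≤ w.asIdeal → ¬ w.asIdeal ∣ I)
    {u : ℝ} (hu : Real.log y - ((m : ℝ) + 1) / A ≤ u) :
    ∑ I ∈ Pset with artinSymbol f I = τ,
        phi A m (u - Real.log (Ideal.absNorm I)) / (Ideal.absNorm I : ℝ) ≤
      rayMeanValueConst K 𝔪 h𝔪 (Nat.card G) A m z y := by
  have hsift := sifted_fiberSum_le h𝔪 hray hsep τ hA hm u hz
  set X := ⌊Real.exp (u + ((m : ℝ) + 1) / A)⌋₊ with hX
  set Aset := (Ideal.finite_setOf_absNorm_le (S := 𝓞 K) X).toFinset with hAset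
  set T := Aset.filter (fun I ↦ ∀ w : HeightOneSpectrum (𝓞 K), (Ideal.absNorm w.asIdeal : ℝ) ≤ z →
    ¬ 𝔪 ≤ w.asIdeal → ¬ w.asIdeal ∣ I) with hT
  set w : Ideal (𝓞 K) → ℝ := fun I ↦ (if I ≠ ⊥ ∧ IsCoprime I 𝔪 ∧ artinSymbol f I = τ then (1 : ℝ) else 0) *
    ((Ideal.absNorm I : ℕ) : ℝ)⁻¹ * phi A m (u - Real.log (Ideal.absNorm I)) with hw
  have hw0 : ∀ I, 0 ≤ w I := by
    intro I; rw [hw]; dsimp only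
    refine mul_nonneg (mul_nonneg ?_ (by positivity)) (phi_nonneg hA m _)
    split_ifs <;> norm_num
  set P' := (Pset.filter (fun I ↦ artinSymbol f I = τ)).filter (fun I ↦ Ideal.absNorm I ≤ X) with hP'
  have hrestrict : ∑ I ∈ Pset with artinSymbol f I = τ,
      phi A m (u - Real.log (Ideal.absNorm I)) / (Ideal.absNorm I : ℝ) = ∑ I ∈ P', w I := by
    conv_rhs => rw [hP', Finset.sum_filter]
    refine Finset.sum_congr rfl fun I hI ↦ ?_
    obtain ⟨hIP, hIC⟩ := mem_filter.mp hI
    split_ifs with hle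
    · rw [hw]; dsimp only
      rw [if_pos ⟨h0 I hIP, hcop I hIP, hIC⟩, one_mul, div_eq_inv_mul]
    · rw [not_le] at hle
      have : Real.exp (u + ((m : ℝ) + 1) / A) < Ideal.absNorm I := (Nat.floor_lt (Real.exp_pos _).le).mp hle
      rw [show (Ideal.absNorm I : ℝ) = ((Ideal.absNorm I : ℕ) : ℝ) from rfl,
        phi_sub_log_eq_zero hA m u this, zero_div]
  rw [hrestrict]
  have hle1 : ∑ I ∈ P', w I ≤ ∑ I ∈ T, w I := by
    refine Finset.sum_le_sum_of_subset_of_nonneg ?_ fun I _ _ ↦ hw0 I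
    intro I hI
    rw [hP', mem_filter, mem_filter] at hI
    obtain ⟨⟨hIP, -⟩, hIX⟩ := hI
    rw [hT, mem_filter, hAset, Set.Finite.mem_toFinset, Set.mem_setOf_eq]
    exact ⟨hIX, hsft I hIP⟩
  have hsift' : ∑ I ∈ T, w I ≤
      (coprimeResidue K 𝔪 h𝔪 / Nat.card G) /
          bigV (fun v : HeightOneSpectrum (𝓞 K) ↦ (Ideal.absNorm v.asIdeal : ℝ)) (admissibleCoprime K 𝔪 z) +
        ((admissibleCoprime K 𝔪 z).card : ℝ) ^ 2 * (rayErr K 𝔪 A m u * z) := by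
    have := hsift
    rw [rayErr]
    exact this
  refine hle1.trans (hsift'.trans ?_)
  rw [rayMeanValueConst]
  refine add_le_add le_rfl (mul_le_mul_of_nonneg_left ?_ (sq_nonneg _))
  refine mul_le_mul_of_nonneg_right ?_ (by linarith)
  exact rayErr_antitone (K := K) 𝔪 A m hu

/-! ### The pointwise bound in `u` -/

/-- **The pointwise bound**: for nonzero ideals `𝔫 ∈ P` prime to `𝔪`, sifted as above, of norm `> y ≥ z`,
and every real `u`: `Σ_χ |Σ_{𝔫∈P} b(𝔫) χ(F(𝔫)) φ(u − log N𝔫)|² ≤ |G| M Σ_{𝔫∈P} N𝔫 |b(𝔫)|² φ(u − log N𝔫)`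
(Parseval on `G`, Cauchy–Schwarz inside each coset, `sum_sifted_fiber_phi_div_le`).
[cite: ThornerZaman2017, Theorem 4.1] -/
theorem sum_norm_sq_smoothed_fiber_le (h𝔪 : 𝔪 ≠ ⊥) (hray : ArtinKillsRay 𝔪 f)
    (hsep : ∀ χ : AddChar (Additive G) ℂ, χ ≠ 0 →
      ∃ v : HeightOneSpectrum (𝓞 K), ¬ 𝔪 ≤ v.asIdeal ∧ χ (Additive.ofMul (f v)) ≠ 1)
    (Pset : Finset (Ideal (𝓞 K))) (b : Ideal (𝓞 K) → ℂ)
    {A : ℝ} (hA : 0 < A) {m : ℕ} (hm : Module.finrank ℚ K + 3 ≤ m) {z y : ℝ} (hz : 1 ≤ z) (hzy : z ≤ y)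
    (h0 : ∀ I ∈ Pset, I ≠ ⊥) (hcop : ∀ I ∈ Pset, IsCoprime I 𝔪)
    (hsft : ∀ I ∈ Pset, ∀ w : HeightOneSpectrum (𝓞 K), (Ideal.absNorm w.asIdeal : ℝ) ≤ z →
      ¬ 𝔪 ≤ w.asIdeal → ¬ w.asIdeal ∣ I)
    (hy : ∀ I ∈ Pset, y < (Ideal.absNorm I : ℝ)) (u : ℝ) :
    ∑ ψ : AddChar (Additive G) ℂ,
        ‖∑ I ∈ Pset, b I * ψ (Additive.ofMul (artinSymbol f I)) *
          (phi A m (u - Real.log (Ideal.absNorm I)) : ℂ)‖ ^ 2 ≤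
      Nat.card G * rayMeanValueConst K 𝔪 h𝔪 (Nat.card G) A m z y *
        ∑ I ∈ Pset, (Ideal.absNorm I : ℝ) * ‖b I‖ ^ 2 * phi A m (u - Real.log (Ideal.absNorm I)) := by
  letI : Fintype G := Fintype.ofFinite G
  rw [Nat.card_eq_fintype_card]
  set φv : Ideal (𝓞 K) → ℝ := fun I ↦ phi A m (u - Real.log (Ideal.absNorm I)) with hφv
  have hφ0 : ∀ I, 0 ≤ φv I := fun I ↦ phi_nonneg hA m _
  set M := rayMeanValueConst K 𝔪 h𝔪 (Fintype.card G) A m z y with hM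
  have hM0 : 0 ≤ M := rayMeanValueConst_nonneg h𝔪 _ A m hz y
  have hcard : (0 : ℝ) ≤ Fintype.card G := Nat.cast_nonneg _
  change ∑ ψ : AddChar (Additive G) ℂ,
      ‖∑ I ∈ Pset, b I * ψ (Additive.ofMul (artinSymbol f I)) * (φv I : ℂ)‖ ^ 2 ≤
    Fintype.card G * M * ∑ I ∈ Pset, (Ideal.absNorm I : ℝ) * ‖b I‖ ^ 2 * φv I
  have hk : 0 < ((m : ℝ) + 1) / A := by positivity
  by_cases hu : Real.log y - ((m : ℝ) + 1) / A ≤ u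
  swap
  · rw [not_le] at hu
    have hzero : ∀ I ∈ Pset, φv I = 0 := by
      intro I hI
      have hNv : (0 : ℝ) < Ideal.absNorm I := by linarith [hy I hI]
      have hlog : Real.log y < Real.log (Ideal.absNorm I) := Real.log_lt_log (by linarith) (hy I hI)
      rw [hφv]; dsimp only
      refine phi_eq_zero_of_lt hA m ?_
      rw [abs_of_neg (by linarith)]
      linarith
    have hl : ∀ ψ : AddChar (Additive G) ℂ,
        ∑ I ∈ Pset, b I * ψ (Additive.ofMul (artinSymbol f I)) * (φv I : ℂ) = 0 := by
      intro ψ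
      exact Finset.sum_eq_zero fun I hI ↦ by rw [hzero I hI]; simp
    simp_rw [hl, norm_zero]
    rw [zero_pow two_ne_zero, sum_const_zero]
    refine mul_nonneg (mul_nonneg hcard hM0) (Finset.sum_nonneg fun I _ ↦ ?_)
    exact mul_nonneg (mul_nonneg (Nat.cast_nonneg _) (sq_nonneg _)) (hφ0 I)
  -- coset sums
  set B : G → ℂ := fun C ↦ ∑ I ∈ Pset with artinSymbol f I = C, b I * (φv I : ℂ) with hB
  have hrw : ∀ ψ : AddChar (Additive G) ℂ,
      ∑ I ∈ Pset, b I * ψ (Additive.ofMul (artinSymbol f I)) * (φv I : ℂ) =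
        ∑ C : G, ψ (Additive.ofMul C) * B C := by
    intro ψ
    rw [← Finset.sum_fiberwise Pset (fun I ↦ artinSymbol f I)]
    refine Finset.sum_congr rfl fun C _ ↦ ?_
    rw [hB]; dsimp only
    rw [Finset.mul_sum]
    refine Finset.sum_congr rfl fun I hI ↦ ?_
    rw [(mem_filter.mp hI).2]; ring
  simp_rw [hrw]
  rw [sum_norm_sq_charSum_eq_card_mul]
  have hCS : ∀ C : G, ‖B C‖ ^ 2 ≤
      (∑ I ∈ Pset with artinSymbol f I = C, (Ideal.absNorm I : ℝ) * ‖b I‖ ^ 2 * φv I) * M := by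
    intro C
    have h1 : ‖B C‖ ≤ ∑ I ∈ Pset with artinSymbol f I = C, ‖b I‖ * φv I := by
      refine (norm_sum_le _ _).trans (le_of_eq (Finset.sum_congr rfl fun I _ ↦ ?_))
      rw [norm_mul, Complex.norm_real, Real.norm_eq_abs, abs_of_nonneg (hφ0 I)]
    have h2 := Finset.sum_sq_le_sum_mul_sum_of_sq_le_mul (Pset.filter fun I ↦ artinSymbol f I = C)
      (r := fun I ↦ ‖b I‖ * φv I) (f := fun I ↦ (Ideal.absNorm I : ℝ) * ‖b I‖ ^ 2 * φv I)
      (g := fun I ↦ φv I / (Ideal.absNorm I : ℝ))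
      (fun I _ ↦ mul_nonneg (mul_nonneg (Nat.cast_nonneg _) (sq_nonneg _)) (hφ0 I))
      (fun I _ ↦ div_nonneg (hφ0 I) (Nat.cast_nonneg _))
      (fun I hI ↦ by
        have hN : (0 : ℝ) < Ideal.absNorm I := by
          have hne : I ≠ ⊥ := h0 I (mem_filter.mp hI).1
          exact_mod_cast Nat.pos_of_ne_zero (mt Ideal.absNorm_eq_zero_iff.mp hne)
        rw [show (‖b I‖ * φv I) ^ 2 = (Ideal.absNorm I : ℝ) * ‖b I‖ ^ 2 * φv I *
          (φv I / (Ideal.absNorm I : ℝ)) by field_simp])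
    have h3 := sum_sifted_fiber_phi_div_le h𝔪 hray hsep Pset C hA hm hz h0 hcop hsft (y := y) hu
    rw [Nat.card_eq_fintype_card] at h3
    have h00 : 0 ≤ ∑ I ∈ Pset with artinSymbol f I = C, (Ideal.absNorm I : ℝ) * ‖b I‖ ^ 2 * φv I :=
      Finset.sum_nonneg fun I _ ↦ mul_nonneg (mul_nonneg (Nat.cast_nonneg _) (sq_nonneg _)) (hφ0 I)
    calc ‖B C‖ ^ 2 ≤ (∑ I ∈ Pset with artinSymbol f I = C, ‖b I‖ * φv I) ^ 2 :=
          pow_le_pow_left₀ (norm_nonneg _) h1 2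
      _ ≤ _ := h2
      _ ≤ _ := mul_le_mul_of_nonneg_left h3 h00
  calc (Fintype.card G : ℝ) * ∑ C : G, ‖B C‖ ^ 2
      ≤ (Fintype.card G : ℝ) * ∑ C : G,
          (∑ I ∈ Pset with artinSymbol f I = C, (Ideal.absNorm I : ℝ) * ‖b I‖ ^ 2 * φv I) * M :=
        mul_le_mul_of_nonneg_left (Finset.sum_le_sum fun C _ ↦ hCS C) hcard
    _ = _ := by
        rw [← Finset.sum_mul, Finset.sum_fiberwise Pset (fun I ↦ artinSymbol f I)
          (fun I ↦ (Ideal.absNorm I : ℝ) * ‖b I‖ ^ 2 * φv I)]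
        ring

/-! ### The mean value theorem -/

/-- **Thorner–Zaman Theorem 4.1 for a congruence class group `mod 𝔪`** (log-free mean value / large sieve),
sums over ideals: for complex `b(𝔫)` on finitely many nonzero ideals `𝔫` prime to `𝔪`, all of norm `> y`
and free of prime factors `𝔭 ∤ 𝔪` of norm `≤ z` (`1 ≤ z ≤ y`), Weiss's kernel of order `m + 1 ≥ n_K + 4`,
parameter `A > 0`, and `0 < T` with `(m+1)T² ≤ 3A²`:
`Σ_χ ∫_{−T}^{T} |Σ_𝔫 b(𝔫) χ(F(𝔫)) N𝔫^{−it}|² dt ≤ 8π |G| M Σ_𝔫 N𝔫 |b(𝔫)|²`, `M = rayMeanValueConst`.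
[cite: ThornerZaman2017, Theorem 4.1] -/
theorem congruence_meanValue_le (h𝔪 : 𝔪 ≠ ⊥) (hray : ArtinKillsRay 𝔪 f)
    (hsep : ∀ χ : AddChar (Additive G) ℂ, χ ≠ 0 →
      ∃ v : HeightOneSpectrum (𝓞 K), ¬ 𝔪 ≤ v.asIdeal ∧ χ (Additive.ofMul (f v)) ≠ 1)
    (Pset : Finset (Ideal (𝓞 K))) (b : Ideal (𝓞 K) → ℂ)
    {A : ℝ} (hA : 0 < A) {m : ℕ} (hm : Module.finrank ℚ K + 3 ≤ m) {T : ℝ} (hT : 0 < T)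
    (hTA : ((m : ℝ) + 1) * T ^ 2 ≤ 3 * A ^ 2) {z y : ℝ} (hz : 1 ≤ z) (hzy : z ≤ y)
    (h0 : ∀ I ∈ Pset, I ≠ ⊥) (hcop : ∀ I ∈ Pset, IsCoprime I 𝔪)
    (hsft : ∀ I ∈ Pset, ∀ w : HeightOneSpectrum (𝓞 K), (Ideal.absNorm w.asIdeal : ℝ) ≤ z →
      ¬ 𝔪 ≤ w.asIdeal → ¬ w.asIdeal ∣ I)
    (hy : ∀ I ∈ Pset, y < (Ideal.absNorm I : ℝ)) :
    ∑ ψ : AddChar (Additive G) ℂ,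
        ∫ t in -T..T, ‖∑ I ∈ Pset, b I * ψ (Additive.ofMul (artinSymbol f I)) *
          Complex.exp (-(t * Real.log (Ideal.absNorm I)) * Complex.I)‖ ^ 2 ≤
      8 * π * (Nat.card G * rayMeanValueConst K 𝔪 h𝔪 (Nat.card G) A m z y *
        ∑ I ∈ Pset, (Ideal.absNorm I : ℝ) * ‖b I‖ ^ 2) := by
  have hm1 : 1 ≤ m := by omega
  set l : Ideal (𝓞 K) → ℝ := fun I ↦ Real.log (Ideal.absNorm I) with hl
  have hG : ∀ ψ : AddChar (Additive G) ℂ,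
      ∫ t in -T..T, ‖∑ I ∈ Pset, b I * ψ (Additive.ofMul (artinSymbol f I)) *
          Complex.exp (-(t * l I) * Complex.I)‖ ^ 2 ≤
        8 * π * ∫ u, ‖∑ I ∈ Pset, b I * ψ (Additive.ofMul (artinSymbol f I)) * (phi A m (u - l I) : ℂ)‖ ^ 2 :=
    fun ψ ↦ gallagher hA m hT hTA Pset (fun I ↦ b I * ψ (Additive.ofMul (artinSymbol f I))) l
  refine (Finset.sum_le_sum fun ψ _ ↦ hG ψ).trans ?_
  rw [← Finset.mul_sum, ← integral_finsetSum _ (fun ψ _ ↦ integrable_norm_sq_sum_phi hA hm1 Pset _ l)]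
  refine mul_le_mul_of_nonneg_left ?_ (by positivity)
  have hint : Integrable fun u : ℝ ↦ Nat.card G * rayMeanValueConst K 𝔪 h𝔪 (Nat.card G) A m z y *
      ∑ I ∈ Pset, (Ideal.absNorm I : ℝ) * ‖b I‖ ^ 2 * phi A m (u - l I) :=
    (integrable_finsetSum Pset fun I _ ↦ ((integrable_phi A m).comp_sub_right (l I)).const_mul _).const_mul _
  have hval : ∫ u : ℝ, Nat.card G * rayMeanValueConst K 𝔪 h𝔪 (Nat.card G) A m z y *
      ∑ I ∈ Pset, (Ideal.absNorm I : ℝ) * ‖b I‖ ^ 2 * phi A m (u - l I) =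
      Nat.card G * rayMeanValueConst K 𝔪 h𝔪 (Nat.card G) A m z y *
        ∑ I ∈ Pset, (Ideal.absNorm I : ℝ) * ‖b I‖ ^ 2 := by
    rw [integral_const_mul, integral_finsetSum _ (fun I _ ↦ ((integrable_phi A m).comp_sub_right (l I)).const_mul _)]
    congr 1
    refine Finset.sum_congr rfl fun I _ ↦ ?_
    rw [integral_const_mul, integral_sub_right_eq_self (fun u ↦ phi A m u) (l I), integral_phi hA m, mul_one]
  rw [← hval]
  refine integral_mono_of_nonneg (Eventually.of_forall fun u ↦ Finset.sum_nonneg fun ψ _ ↦ by positivity) hint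
    (Eventually.of_forall fun u ↦ ?_)
  exact sum_norm_sq_smoothed_fiber_le h𝔪 hray hsep Pset b hA hm hz hzy h0 hcop hsft hy u

/-- A prime of norm `> z` is not divisible by a prime of norm `≤ z`. [cite: ThornerZaman2017, Theorem 4.1] -/
private theorem not_dvd_of_absNorm_lt' {z : ℝ} {v w : HeightOneSpectrum (𝓞 K)} (hv : z < (Ideal.absNorm v.asIdeal : ℝ))
    (hw : (Ideal.absNorm w.asIdeal : ℝ) ≤ z) : ¬ w.asIdeal ∣ v.asIdeal :=
  not_dvd_of_absNorm_lt hv hw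

/-- **Thorner–Zaman Theorem 4.1 for a congruence class group `mod 𝔪`, prime ideals** `𝔭 ∤ 𝔪` of norm
`> y ≥ z ≥ 1` (they are `z`-sifted and prime to `𝔪`):
`Σ_χ ∫_{−T}^{T} |Σ_𝔭 b(𝔭) χ(f 𝔭) N𝔭^{−it}|² dt ≤ 8π |G| M Σ_𝔭 N𝔭 |b(𝔭)|²`. [cite: ThornerZaman2017, Theorem 4.1] -/
theorem congruence_meanValue_primes_le (h𝔪 : 𝔪 ≠ ⊥) (hray : ArtinKillsRay 𝔪 f)
    (hsep : ∀ χ : AddChar (Additive G) ℂ, χ ≠ 0 →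
      ∃ v : HeightOneSpectrum (𝓞 K), ¬ 𝔪 ≤ v.asIdeal ∧ χ (Additive.ofMul (f v)) ≠ 1)
    (Pset : Finset (HeightOneSpectrum (𝓞 K))) (b : HeightOneSpectrum (𝓞 K) → ℂ)
    {A : ℝ} (hA : 0 < A) {m : ℕ} (hm : Module.finrank ℚ K + 3 ≤ m) {T : ℝ} (hT : 0 < T)
    (hTA : ((m : ℝ) + 1) * T ^ 2 ≤ 3 * A ^ 2) {z y : ℝ} (hz : 1 ≤ z) (hzy : z ≤ y)
    (hP𝔪 : ∀ v ∈ Pset, ¬ 𝔪 ≤ v.asIdeal)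
    (hy : ∀ v ∈ Pset, y < (Ideal.absNorm v.asIdeal : ℝ)) :
    ∑ ψ : AddChar (Additive G) ℂ,
        ∫ t in -T..T, ‖∑ v ∈ Pset, b v * ψ (Additive.ofMul (f v)) *
          Complex.exp (-(t * Real.log (Ideal.absNorm v.asIdeal)) * Complex.I)‖ ^ 2 ≤
      8 * π * (Nat.card G * rayMeanValueConst K 𝔪 h𝔪 (Nat.card G) A m z y *
        ∑ v ∈ Pset, (Ideal.absNorm v.asIdeal : ℝ) * ‖b v‖ ^ 2) := by
  set e : HeightOneSpectrum (𝓞 K) → Ideal (𝓞 K) := fun v ↦ v.asIdeal with he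
  have hinj : Function.Injective e := fun _ _ h ↦ HeightOneSpectrum.ext h
  set b' : Ideal (𝓞 K) → ℂ := fun I ↦ if h : ∃ v ∈ Pset, v.asIdeal = I then b h.choose else 0 with hb'
  have hb'e : ∀ v ∈ Pset, b' (e v) = b v := by
    intro v hv
    have hex : ∃ v' ∈ Pset, v'.asIdeal = e v := ⟨v, hv, rfl⟩
    rw [hb']; dsimp only
    rw [dif_pos hex]
    congr 1
    exact hinj hex.choose_spec.2
  have hart : ∀ v : HeightOneSpectrum (𝓞 K), artinSymbol f (e v) = f v := fun v ↦ artinSymbol_asIdeal f v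
  have h := congruence_meanValue_le h𝔪 hray hsep (Pset.image e) b' hA hm hT hTA hz hzy
    (fun I hI ↦ by obtain ⟨v, -, rfl⟩ := Finset.mem_image.mp hI; exact v.ne_bot)
    (fun I hI ↦ by
      obtain ⟨v, hv, rfl⟩ := Finset.mem_image.mp hI
      exact (isCoprime_of_isMaximal_of_not_le v.isMaximal (hP𝔪 v hv)).symm)
    (fun I hI w hw _ ↦ by
      obtain ⟨v, hv, rfl⟩ := Finset.mem_image.mp hI
      exact not_dvd_of_absNorm_lt' (lt_of_le_of_lt hzy (hy v hv)) hw)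
    (fun I hI ↦ by obtain ⟨v, hv, rfl⟩ := Finset.mem_image.mp hI; exact hy v hv)
  rw [Finset.sum_image (fun v _ w _ h ↦ hinj h)] at h
  simp_rw [Finset.sum_image (fun v _ w _ h ↦ hinj h)] at h
  have hL : ∀ ψ : AddChar (Additive G) ℂ,
      (fun t : ℝ ↦ ‖∑ v ∈ Pset, b v * ψ (Additive.ofMul (f v)) *
          Complex.exp (-(t * Real.log (Ideal.absNorm v.asIdeal)) * Complex.I)‖ ^ 2) =
        fun t : ℝ ↦ ‖∑ v ∈ Pset, b' (e v) * ψ (Additive.ofMul (artinSymbol f (e v))) *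
          Complex.exp (-(t * Real.log (Ideal.absNorm (e v))) * Complex.I)‖ ^ 2 := by
    intro ψ; funext t
    congr 2
    exact Finset.sum_congr rfl fun v hv ↦ by rw [hb'e v hv, hart v]
  have hR : ∑ v ∈ Pset, (Ideal.absNorm v.asIdeal : ℝ) * ‖b v‖ ^ 2 =
      ∑ v ∈ Pset, (Ideal.absNorm (e v) : ℝ) * ‖b' (e v)‖ ^ 2 :=
    Finset.sum_congr rfl fun v hv ↦ by rw [hb'e v hv]
  simp_rw [hL]
  rw [hR]
  exact h

end Literature.NumberTheory.LFunctions.AbelianDensity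

end
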